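import Mathlib
import Summits.KontsevichZagierPeriods.KontsevichZagierPeriods.Theses.IsogenyCertificates
import Literature.NumberTheory.Transcendental.KZRelationsLE

/-!
# Sketch — crux-ideate `stmt-KontsevichZagierPeriods-10664` (`IsogenyCertificates.EffectiveXMapChains`),
round 1, ideator 2.

First lemmas of the three idea cards, stated over existing declarations, plus two PROVED
reductions:

* `CountedTransfer d budget` — the counted x-map transfer: for every x-rational isogeny datum of
  degree `≤ N`, every equal-valued pair `r = [{P>0}, a/√P]`, `r' = [{P'>0}, b/√P']` is joined by a
  chain of at most `budget N` signed move instances inside dimension `≤ d`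
  (`KZ.ChainLE d (budget N)`);
* `CountedTransferLinear` (C⁺ of card `branch-locus-full-sheets`: `d = 1`, budget `L₀·N + L₁`) and
  `ConstantTransfer` (C⁺⁺ of card `stack-the-sheets`: `d = 2`, constant budget);
* `effectiveXMapChains_of_countedTransferLinear`, `effectiveXMapChains_of_constantTransfer` —
  PROVED: either C⁺ implies the crux (the inline Masser–Wüstholz hypothesis is used only to bound
  `N`, resp. not at all);
* `FullSheets`, `FullSheetsOneFamily` (card `branch-locus-full-sheets`), `dupDatum` (card
  `duplicate-to-kill-the-egg`; the universal duplication datum, checked by `ring`), `DatumComp`,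
  `Thickening` (card `stack-the-sheets`).
-/

open Polynomial Set
open Literature.NumberTheory.Transcendental

set_option linter.dupNamespace false

namespace Summit.KontsevichZagierPeriods.KontsevichZagierPeriods.Cruxes.EffectiveXMapChains.SketchIdeator2

/-- The typed x-rational isogeny datum of the route (verbatim the conjuncts of the crux). -/
def IsDatum (A B A' B' : ℤ) (f g : ℚ[X]) (c : ℚ) : Prop :=
  derivative f * g - f * derivative g ≠ 0 ∧
    C (c ^ 2) * g * (f ^ 3 + C (A' : ℚ) * f * g ^ 2 + C (B' : ℚ) * g ^ 3) =
      (X ^ 3 + C (A : ℚ) * X + C (B : ℚ)) * (derivative f * g - f * derivative g) ^ 2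

/-- **Counted transfer** with dimension budget `d` and length budget `budget N` (C⁺ template). -/
def CountedTransfer (d : ℕ) (budget : ℕ → ℕ) : Prop :=
  ∀ (N : ℕ) (A B A' B' : ℤ), 4 * A ^ 3 + 27 * B ^ 2 ≠ 0 → 4 * A' ^ 3 + 27 * B' ^ 2 ≠ 0 →
    ∀ (f g : ℚ[X]) (c : ℚ), IsDatum A B A' B' f g c → max f.natDegree g.natDegree ≤ N →
      ∀ (a b : ℚ), 0 < a → 0 < b → ∀ (r r' : KZ.IntegralRep 1),
        r.domain = {x | 0 < x 0 ^ 3 + (A : ℝ) * x 0 + (B : ℝ)} →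
        EqOn r.integrand (fun x => (a : ℝ) / Real.sqrt (x 0 ^ 3 + (A : ℝ) * x 0 + (B : ℝ))) r.domain →
        r'.domain = {x | 0 < x 0 ^ 3 + (A' : ℝ) * x 0 + (B' : ℝ)} →
        EqOn r'.integrand (fun x => (b : ℝ) / Real.sqrt (x 0 ^ 3 + (A' : ℝ) * x 0 + (B' : ℝ))) r'.domain →
        r.value = r'.value →
        KZ.ChainLE d (budget N) (KZ.of r - KZ.of r')

/-- C⁺ of card `branch-locus-full-sheets`: dimension-1 chains of length linear in the degree. -/
def CountedTransferLinear : Prop := ∃ L₀ L₁ : ℕ, CountedTransfer 1 (fun N => L₀ * N + L₁)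

/-- C⁺⁺ of card `stack-the-sheets`: dimension-2 chains of CONSTANT length, every degree. -/
def ConstantTransfer : Prop := ∃ L₀ : ℕ, CountedTransfer 2 (fun _ => L₀)

/-- Unpacking a `ChainLE` into the crux's list shape. -/
theorem exists_list_of_chainLE {d ℓ : ℕ} {e : KZ.FormalRep} (h : KZ.ChainLE d ℓ e) :
    ∃ l : List KZ.FormalRep, l.length ≤ ℓ ∧
      (∀ x ∈ l, x ∈ (KZ.domainAddRel ∪ KZ.integrandAddRel ∪ KZ.changeOfVariablesRel ∪ KZ.newtonLeibnizRel) ∨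
        -x ∈ (KZ.domainAddRel ∪ KZ.integrandAddRel ∪ KZ.changeOfVariablesRel ∪ KZ.newtonLeibnizRel)) ∧
      l.sum = e := by
  obtain ⟨l, hl, hmem, hsum⟩ := h
  refine ⟨l, hl, fun x hx => ?_, hsum⟩
  rcases hmem x hx with h | h
  · exact Or.inl (KZ.movesLE_subset d h)
  · exact Or.inr (KZ.movesLE_subset d h)

/-- **PROVED reduction (card `stack-the-sheets`).** A constant chain budget gives the crux with
`k = 0`; the Masser–Wüstholz hypothesis is not used. -/
theorem effectiveXMapChains_of_constantTransfer (h : ConstantTransfer) :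
    Theses.IsogenyCertificates.EffectiveXMapChains := by
  intro _hyp
  obtain ⟨L₀, hT⟩ := h
  refine ⟨(L₀ : ℝ), 0, ?_⟩
  intro A B A' B' hΔ hΔ' hdat a b ha hb r r' h1 h2 h3 h4 h5
  obtain ⟨f, g, c, hW, hI⟩ := hdat
  have hch := hT (max f.natDegree g.natDegree) A B A' B' hΔ hΔ' f g c ⟨hW, hI⟩ le_rfl
    a b ha hb r r' h1 h2 h3 h4 h5
  obtain ⟨l, hl, hmem, hsum⟩ := exists_list_of_chainLE hch
  refine ⟨l, ?_, hmem, hsum⟩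
  rw [Real.rpow_zero, mul_one]
  exact_mod_cast hl

/-- **PROVED reduction (card `branch-locus-full-sheets`).** A chain budget linear in the degree of
the datum gives the crux with `k = max κ 0`, `C = L₀|c₀| + L₁`. -/
theorem effectiveXMapChains_of_countedTransferLinear (h : CountedTransferLinear) :
    Theses.IsogenyCertificates.EffectiveXMapChains := by
  rintro ⟨κ, c₀, hhyp⟩
  obtain ⟨L₀, L₁, hT⟩ := h
  refine ⟨(L₀ : ℝ) * |c₀| + L₁, max κ 0, ?_⟩
  intro A B A' B' hΔ hΔ' hdat a b ha hb r r' h1 h2 h3 h4 h5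
  obtain ⟨f, g, c, hW, hI, hdeg⟩ := hhyp A B A' B' hΔ hΔ' hdat
  set N := max f.natDegree g.natDegree with hN
  have hch := hT N A B A' B' hΔ hΔ' f g c ⟨hW, hI⟩ le_rfl a b ha hb r r' h1 h2 h3 h4 h5
  obtain ⟨l, hl, hmem, hsum⟩ := exists_list_of_chainLE hch
  refine ⟨l, ?_, hmem, hsum⟩
  -- the arithmetic: l.length ≤ L₀ N + L₁ ≤ (L₀ |c₀| + L₁) · L ^ max κ 0
  set u : ℝ := max |(A : ℝ)| |(B : ℝ)| with hu
  set v : ℝ := max (max |(A : ℝ)| |(B : ℝ)|) (max |(A' : ℝ)| |(B' : ℝ)|) with hv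
  set L₁' : ℝ := max 1 (Real.log u) with hL₁'
  set L : ℝ := max 1 (Real.log v) with hL
  have h1L₁' : (1 : ℝ) ≤ L₁' := le_max_left _ _
  have h1L : (1 : ℝ) ≤ L := le_max_left _ _
  have huv : u ≤ v := le_max_left _ _
  have hu0 : 0 ≤ u := le_trans (abs_nonneg _) (le_max_left _ _)
  have hL₁'L : L₁' ≤ L := by
    by_cases hu' : 0 < u
    · exact max_le_max le_rfl (Real.log_le_log hu' huv)
    · have : u = 0 := le_antisymm (not_lt.mp hu') hu0
      rw [hL₁', this, Real.log_zero, max_eq_left zero_le_one]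
      exact h1L
  have hk : (0 : ℝ) ≤ max κ 0 := le_max_right _ _
  have hNreal : (N : ℝ) ≤ |c₀| * L ^ (max κ 0) := by
    have e1 : (N : ℝ) ≤ c₀ * L₁' ^ κ := by exact_mod_cast hdeg
    have e2 : c₀ * L₁' ^ κ ≤ |c₀| * L₁' ^ κ :=
      mul_le_mul_of_nonneg_right (le_abs_self c₀) (Real.rpow_nonneg (le_trans zero_le_one h1L₁') κ)
    have e3 : L₁' ^ κ ≤ L₁' ^ (max κ 0) := Real.rpow_le_rpow_of_exponent_le h1L₁' (le_max_left _ _)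
    have e4 : L₁' ^ (max κ 0) ≤ L ^ (max κ 0) :=
      Real.rpow_le_rpow (le_trans zero_le_one h1L₁') hL₁'L hk
    calc (N : ℝ) ≤ |c₀| * L₁' ^ κ := e1.trans e2
      _ ≤ |c₀| * L ^ (max κ 0) := mul_le_mul_of_nonneg_left (e3.trans e4) (abs_nonneg c₀)
  have hLk : (1 : ℝ) ≤ L ^ (max κ 0) := Real.one_le_rpow h1L hk
  have hlen : (l.length : ℝ) ≤ (L₀ : ℝ) * N + L₁ := by exact_mod_cast hl
  calc (l.length : ℝ) ≤ (L₀ : ℝ) * N + L₁ := hlen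
    _ ≤ (L₀ : ℝ) * (|c₀| * L ^ (max κ 0)) + L₁ * L ^ (max κ 0) := by
        gcongr
        · exact le_mul_of_one_le_right (Nat.cast_nonneg _) hLk
    _ = ((L₀ : ℝ) * |c₀| + L₁) * L ^ (max κ 0) := by ring

/-! ### Card `branch-locus-full-sheets` — first lemma -/

/-- **FullSheets.** For a COPRIME datum, the x-map `R = f/g` sends every connected component of
`S = {P > 0, g ≠ 0, W ≠ 0}` ONTO a whole connected component of `S' = {P' > 0}` (branch points,
critical points and `∞` go to roots of `P'` or to `∞`). -/
def FullSheets : Prop :=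
  ∀ (A B A' B' : ℤ) (f g : ℚ[X]) (c : ℚ), 4 * A ^ 3 + 27 * B ^ 2 ≠ 0 → 4 * A' ^ 3 + 27 * B' ^ 2 ≠ 0 →
    IsDatum A B A' B' f g c → IsCoprime f g →
    let fR : ℝ → ℝ := fun x => (f.map (algebraMap ℚ ℝ)).eval x
    let gR : ℝ → ℝ := fun x => (g.map (algebraMap ℚ ℝ)).eval x
    let WR : ℝ → ℝ := fun x => ((derivative f * g - f * derivative g).map (algebraMap ℚ ℝ)).eval x
    let S : Set ℝ := {x | 0 < x ^ 3 + (A : ℝ) * x + (B : ℝ) ∧ gR x ≠ 0 ∧ WR x ≠ 0}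
    let S' : Set ℝ := {x | 0 < x ^ 3 + (A' : ℝ) * x + (B' : ℝ)}
    ∀ x ∈ S, (fun y => fR y / gR y) '' connectedComponentIn S x = connectedComponentIn S' (fR x / gR x)

/-- **FullSheetsOneFamily.** All sheets inside ONE component of `{P > 0}` cover the SAME component
of `{P' > 0}` (adjacent sheets share a pole, whose image is the unbounded component, or a critical
value `e'`, which is an endpoint of exactly one component). -/
def FullSheetsOneFamily : Prop :=
  ∀ (A B A' B' : ℤ) (f g : ℚ[X]) (c : ℚ), 4 * A ^ 3 + 27 * B ^ 2 ≠ 0 → 4 * A' ^ 3 + 27 * B' ^ 2 ≠ 0 →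
    IsDatum A B A' B' f g c → IsCoprime f g →
    let fR : ℝ → ℝ := fun x => (f.map (algebraMap ℚ ℝ)).eval x
    let gR : ℝ → ℝ := fun x => (g.map (algebraMap ℚ ℝ)).eval x
    let WR : ℝ → ℝ := fun x => ((derivative f * g - f * derivative g).map (algebraMap ℚ ℝ)).eval x
    let T : Set ℝ := {x | 0 < x ^ 3 + (A : ℝ) * x + (B : ℝ)}
    let S' : Set ℝ := {x | 0 < x ^ 3 + (A' : ℝ) * x + (B' : ℝ)}
    ∀ x₁ ∈ T, ∀ x₂ ∈ T, gR x₁ ≠ 0 → WR x₁ ≠ 0 → gR x₂ ≠ 0 → WR x₂ ≠ 0 →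
      connectedComponentIn T x₁ = connectedComponentIn T x₂ →
      connectedComponentIn S' (fR x₁ / gR x₁) = connectedComponentIn S' (fR x₂ / gR x₂)

/-- The number of sheets is linear in the degree: `S` has at most `3N + 4` connected components
(`P·g·W` has at most `3 + N + (2N − 1)` real roots). Stated with the tree's finiteness theorem's
object `{C | ∃ x ∈ S, C = connectedComponentIn S x}`. -/
def SheetCount : Prop :=
  ∀ (A B A' B' : ℤ) (f g : ℚ[X]) (c : ℚ), IsDatum A B A' B' f g c →
    let gR : ℝ → ℝ := fun x => (g.map (algebraMap ℚ ℝ)).eval x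
    let WR : ℝ → ℝ := fun x => ((derivative f * g - f * derivative g).map (algebraMap ℚ ℝ)).eval x
    let S : Set ℝ := {x | 0 < x ^ 3 + (A : ℝ) * x + (B : ℝ) ∧ gR x ≠ 0 ∧ WR x ≠ 0}
    ∃ 𝒞 : Finset (Set ℝ), (↑𝒞 : Set (Set ℝ)) = {C | ∃ x ∈ S, C = connectedComponentIn S x} ∧
      𝒞.card ≤ 3 * max f.natDegree g.natDegree + 4

/-! #### Two of the four evaluations behind `FullSheets`, PROVED (pure algebra) -/
/-- Branch values are roots of `P'`: if the datum identity holds, `c ≠ 0`, `g(x) ≠ 0` and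
`P(x)·W(x)² = 0` (x a root of `P`, or a critical point), then `P'(f(x)/g(x)) = 0`. -/
theorem branch_value_root (A B A' B' : ℤ) (f g : ℚ[X]) (c : ℚ)
    (hI : C (c ^ 2) * g * (f ^ 3 + C (A' : ℚ) * f * g ^ 2 + C (B' : ℚ) * g ^ 3) =
      (X ^ 3 + C (A : ℚ) * X + C (B : ℚ)) * (derivative f * g - f * derivative g) ^ 2)
    (hc : c ≠ 0) (x : ℝ) (hg : aeval x g ≠ 0)
    (hx : (x ^ 3 + (A : ℝ) * x + (B : ℝ)) * (aeval x (derivative f * g - f * derivative g)) ^ 2 = 0) :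
    (aeval x f / aeval x g) ^ 3 + (A' : ℝ) * (aeval x f / aeval x g) + (B' : ℝ) = 0 := by
  have h := congrArg (fun p : ℚ[X] => aeval x p) hI
  simp only [map_mul, map_add, map_pow, aeval_C, aeval_X, eq_ratCast,
    Rat.cast_intCast] at h
  rw [hx] at h
  -- h : c^2 * g(x) * (f^3 + A' f g^2 + B' g^3) = 0
  have hc2 : ((c : ℝ)) ^ 2 ≠ 0 := pow_ne_zero 2 (by exact_mod_cast hc)
  have hcore : aeval x f ^ 3 + (A' : ℝ) * aeval x f * aeval x g ^ 2 + (B' : ℝ) * aeval x g ^ 3 = 0 := by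
    have := h
    rcases mul_eq_zero.mp this with h1 | h1
    · rcases mul_eq_zero.mp h1 with h2 | h2
      · exact absurd h2 hc2
      · exact absurd h2 hg
    · linarith [h1]
  field_simp
  linear_combination hcore

/-- Interior points map into `{P' > 0}`: `P(x) > 0`, `g(x) ≠ 0`, `W(x) ≠ 0` ⇒ `P'(f(x)/g(x)) > 0`. -/
theorem interior_value_pos (A B A' B' : ℤ) (f g : ℚ[X]) (c : ℚ)
    (hI : C (c ^ 2) * g * (f ^ 3 + C (A' : ℚ) * f * g ^ 2 + C (B' : ℚ) * g ^ 3) =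
      (X ^ 3 + C (A : ℚ) * X + C (B : ℚ)) * (derivative f * g - f * derivative g) ^ 2)
    (x : ℝ) (hg : aeval x g ≠ 0) (hW : aeval x (derivative f * g - f * derivative g) ≠ 0)
    (hP : 0 < x ^ 3 + (A : ℝ) * x + (B : ℝ)) :
    0 < (aeval x f / aeval x g) ^ 3 + (A' : ℝ) * (aeval x f / aeval x g) + (B' : ℝ) := by
  have h := congrArg (fun p : ℚ[X] => aeval x p) hI
  simp only [map_mul, map_add, map_pow, aeval_C, aeval_X, eq_ratCast,
    Rat.cast_intCast] at h
  set fx := aeval x f with hfx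
  set gx := aeval x g with hgx
  set Wx := aeval x (derivative f * g - f * derivative g) with hWx
  -- h : c^2 * gx * (fx^3 + A' fx gx^2 + B' gx^3) = P(x) * Wx^2 > 0
  have hpos : 0 < (c : ℝ) ^ 2 * gx * (fx ^ 3 + (A' : ℝ) * fx * gx ^ 2 + (B' : ℝ) * gx ^ 3) := by
    rw [h]; positivity
  have key : (fx / gx) ^ 3 + (A' : ℝ) * (fx / gx) + (B' : ℝ) =
      ((c : ℝ) ^ 2 * gx * (fx ^ 3 + (A' : ℝ) * fx * gx ^ 2 + (B' : ℝ) * gx ^ 3)) /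
        ((c : ℝ) ^ 2 * gx ^ 4) := by
    have hc : (c : ℝ) ≠ 0 := by
      rintro hc0
      rw [hc0] at hpos
      simp at hpos
    field_simp
  rw [key]
  apply div_pos hpos
  have hg4 : 0 < gx ^ 4 := by positivity
  have hc2 : 0 < (c : ℝ) ^ 2 := by
    rcases (sq_nonneg (c : ℝ)).lt_or_eq with hlt | heq
    · exact hlt
    · exfalso; rw [← heq] at hpos; simp at hpos
  positivity

/-! ### Card `duplicate-to-kill-the-egg` — first lemmas -/

/-- Derivative of the duplication numerator `X⁴ − 2AX² − 8BX + A²`. -/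
theorem derivative_dupNum (A B : ℚ) :
    derivative (X ^ 4 - C (2 * A) * X ^ 2 - C (8 * B) * X + C (A ^ 2) : ℚ[X]) =
      C 4 * X ^ 3 - C (4 * A) * X - C (8 * B) := by
  simp only [derivative_add, derivative_sub, derivative_mul, derivative_C, derivative_X_pow,
    derivative_X]
  simp only [map_mul, Nat.cast_ofNat, map_ofNat]
  norm_num
  ring

/-- Derivative of the duplication denominator `4(X³ + AX + B)`. -/
theorem derivative_dupDen (A B : ℚ) :
    derivative (C 4 * (X ^ 3 + C A * X + C B) : ℚ[X]) = C 4 * (C 3 * X ^ 2 + C A) := by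
  simp only [derivative_add, derivative_mul, derivative_C, derivative_X_pow, derivative_X]
  simp only [Nat.cast_ofNat, map_ofNat]
  norm_num

/-- **The universal duplication datum** (CERTIFIED here by `ring`): `x([2]P) = f₂/g₂` with
`f₂ = X⁴ − 2AX² − 8BX + A²`, `g₂ = 4(X³ + AX + B)` and `c = 2` is a datum from `(A, B)` to
`(A, B)` in the typed convention `c²·g·(f³ + Afg² + Bg³) = P·W²` (Silverman AEC III.2.3(d);
`[2]^*(dx/y) = 2·dx/y`). -/
theorem dupDatum (A B : ℚ) :
    C ((2 : ℚ) ^ 2) * (C 4 * (X ^ 3 + C A * X + C B)) *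
        ((X ^ 4 - C (2 * A) * X ^ 2 - C (8 * B) * X + C (A ^ 2)) ^ 3 +
          C A * (X ^ 4 - C (2 * A) * X ^ 2 - C (8 * B) * X + C (A ^ 2)) *
            (C 4 * (X ^ 3 + C A * X + C B)) ^ 2 +
          C B * (C 4 * (X ^ 3 + C A * X + C B)) ^ 3) =
      (X ^ 3 + C A * X + C B) *
        (derivative (X ^ 4 - C (2 * A) * X ^ 2 - C (8 * B) * X + C (A ^ 2)) *
            (C 4 * (X ^ 3 + C A * X + C B)) -
          (X ^ 4 - C (2 * A) * X ^ 2 - C (8 * B) * X + C (A ^ 2)) *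
            derivative (C 4 * (X ^ 3 + C A * X + C B))) ^ 2 := by
  rw [derivative_dupNum, derivative_dupDen]
  simp only [map_mul, map_pow, map_ofNat]
  ring

/-- The duplication datum IS an `IsDatum A B A B` instance with `c = 2` (integral `A, B`). -/
theorem isDatum_dup (A B : ℤ) (hW : derivative (X ^ 4 - C (2 * (A : ℚ)) * X ^ 2 - C (8 * (B : ℚ)) * X + C ((A : ℚ) ^ 2)) *
      (C 4 * (X ^ 3 + C (A : ℚ) * X + C (B : ℚ))) -
    (X ^ 4 - C (2 * (A : ℚ)) * X ^ 2 - C (8 * (B : ℚ)) * X + C ((A : ℚ) ^ 2)) *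
      derivative (C 4 * (X ^ 3 + C (A : ℚ) * X + C (B : ℚ))) ≠ 0) :
    IsDatum A B A B (X ^ 4 - C (2 * (A : ℚ)) * X ^ 2 - C (8 * (B : ℚ)) * X + C ((A : ℚ) ^ 2))
      (C 4 * (X ^ 3 + C (A : ℚ) * X + C (B : ℚ))) 2 :=
  ⟨hW, dupDatum (A : ℚ) (B : ℚ)⟩

/-- **The 2-descent square behind "connected image"** (CERTIFIED by `ring`): if `e` is a root of
`P = X³ + AX + B` (so `B = −e³ − Ae`) then `f₂ − e·g₂ = (X² − 2eX − A − 2e²)²`, i.e.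
`x([2]Q) − e = (x_Q² − 2e·x_Q − A − 2e²)² / (4P(x_Q)) ≥ 0` whenever `P(x_Q) > 0`: the x-coordinate of
a real double is `≥` every real root, so `x ∘ [2]` lands in the closure of the UNBOUNDED component
(Knapp, *Elliptic Curves*, Thm 4.2 / Silverman AEC Prop. X.1.4: `P ∈ 2E ⇒ x(P) − eᵢ` squares). -/
theorem dup_sub_root_sq (A e : ℝ) :
    ((X ^ 4 - C (2 * A) * X ^ 2 - C (8 * (-e ^ 3 - A * e)) * X + C (A ^ 2)) -
        C e * (C 4 * (X ^ 3 + C A * X + C (-e ^ 3 - A * e))) : ℝ[X]) =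
      (X ^ 2 - C (2 * e) * X - C (A + 2 * e ^ 2)) ^ 2 := by
  simp only [map_mul, map_pow, map_ofNat, map_neg, map_sub, map_add]
  ring

/-- Homogenised composition of x-maps: `(f₂/g₂) ∘ (f₁/g₁) = f/g` with
`f = Σᵢ (f₂)ᵢ f₁ⁱ g₁^{d−i}`, `g = Σᵢ (g₂)ᵢ f₁ⁱ g₁^{d−i}`, `d = max (deg f₂) (deg g₂)`. -/
noncomputable def compNum (f₁ g₁ f₂ g₂ : ℚ[X]) : ℚ[X] :=
  ∑ i ∈ Finset.range (max f₂.natDegree g₂.natDegree + 1),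
    C (f₂.coeff i) * f₁ ^ i * g₁ ^ (max f₂.natDegree g₂.natDegree - i)

/-- See `compNum`. -/
noncomputable def compDen (f₁ g₁ f₂ g₂ : ℚ[X]) : ℚ[X] :=
  ∑ i ∈ Finset.range (max f₂.natDegree g₂.natDegree + 1),
    C (g₂.coeff i) * f₁ ^ i * g₁ ^ (max f₂.natDegree g₂.natDegree - i)

/-- **DatumComp** (support lemma of card `duplicate-to-kill-the-egg`): data compose, multipliers
multiply, degrees multiply at most. Pure polynomial algebra (`c²P'(R) = P R'²` is multiplicative
under composition of rational functions). -/
def DatumComp : Prop :=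
  ∀ (A B A' B' A'' B'' : ℤ) (f₁ g₁ f₂ g₂ : ℚ[X]) (c₁ c₂ : ℚ),
    X ^ 3 + C (A : ℚ) * X + C (B : ℚ) ≠ 0 →
    IsDatum A B A' B' f₁ g₁ c₁ → IsDatum A' B' A'' B'' f₂ g₂ c₂ → IsCoprime f₁ g₁ →
    IsDatum A B A'' B'' (compNum f₁ g₁ f₂ g₂) (compDen f₁ g₁ f₂ g₂) (c₁ * c₂) ∧
      max (compNum f₁ g₁ f₂ g₂).natDegree (compDen f₁ g₁ f₂ g₂).natDegree ≤
        max f₁.natDegree g₁.natDegree * max f₂.natDegree g₂.natDegree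

/-- **ConnectedImage** (the point of composing with `[2]`): for a datum POST-COMPOSED with the
duplication datum of its target, every sheet lands on the UNBOUNDED component of `{P' > 0}`:
the image of `{P > 0, g ≠ 0, W ≠ 0}` avoids the bounded component. Stated for any datum whose
`x`-map factors as `x([2]·) ∘ R₁`. -/
def ConnectedImageAfterDup : Prop :=
  ∀ (A B A' B' : ℤ) (f₁ g₁ : ℚ[X]) (c₁ : ℚ), 4 * A ^ 3 + 27 * B ^ 2 ≠ 0 → 4 * A' ^ 3 + 27 * B' ^ 2 ≠ 0 →
    IsDatum A B A' B' f₁ g₁ c₁ →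
    let f₂ : ℚ[X] := X ^ 4 - C (2 * (A' : ℚ)) * X ^ 2 - C (8 * (B' : ℚ)) * X + C ((A' : ℚ) ^ 2)
    let g₂ : ℚ[X] := C 4 * (X ^ 3 + C (A' : ℚ) * X + C (B' : ℚ))
    let f := compNum f₁ g₁ f₂ g₂
    let g := compDen f₁ g₁ f₂ g₂
    let fR : ℝ → ℝ := fun x => (f.map (algebraMap ℚ ℝ)).eval x
    let gR : ℝ → ℝ := fun x => (g.map (algebraMap ℚ ℝ)).eval x
    ∀ x : ℝ, 0 < x ^ 3 + (A : ℝ) * x + (B : ℝ) → gR x ≠ 0 →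
      ∀ e : ℝ, e ^ 3 + (A' : ℝ) * e + (B' : ℝ) = 0 → e < fR x / gR x

/-- **OneSidedNormalForm** (C⁺ of card `duplicate-to-kill-the-egg`): every `[{P>0}, a/√P]` is,
within a linear budget, a chain away from an INTEGER MULTIPLE of the single representation
`[unb′, (a/(2|c|))/√P′]` on the unbounded component of `{P′ > 0}` — one-sided (no `r′`, no value
hypothesis), same target component for every datum and every sign of `Δ, Δ′`. Two applications
(to the datum for `r`, to the duplication datum of `(A′, B′)` for `r′`) and value equality give
`CountedTransferLinear`. -/
def OneSidedNormalForm : Prop :=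
  ∃ L₀ L₁ : ℕ, ∀ (N : ℕ) (A B A' B' : ℤ), 4 * A ^ 3 + 27 * B ^ 2 ≠ 0 → 4 * A' ^ 3 + 27 * B' ^ 2 ≠ 0 →
    ∀ (f g : ℚ[X]) (c : ℚ), IsDatum A B A' B' f g c → max f.natDegree g.natDegree ≤ N →
      ∀ a : ℚ, 0 < a → ∀ r : KZ.IntegralRep 1,
        r.domain = {x | 0 < x 0 ^ 3 + (A : ℝ) * x 0 + (B : ℝ)} →
        EqOn r.integrand (fun x => (a : ℝ) / Real.sqrt (x 0 ^ 3 + (A : ℝ) * x 0 + (B : ℝ))) r.domain →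
        ∃ (n : ℕ) (s : KZ.IntegralRep 1),
          s.domain = {x | 0 < x 0 ^ 3 + (A' : ℝ) * x 0 + (B' : ℝ) ∧
            ∀ e : ℝ, e ^ 3 + (A' : ℝ) * e + (B' : ℝ) = 0 → e < x 0} ∧
          EqOn s.integrand (fun x => ((a : ℝ) / (2 * |(c : ℝ)|)) /
            Real.sqrt (x 0 ^ 3 + (A' : ℝ) * x 0 + (B' : ℝ))) s.domain ∧
          KZ.ChainLE 1 (L₀ * N + L₁) (KZ.of r - n • KZ.of s)

/-! ### Card `stack-the-sheets` — first lemma -/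

/-- **Thickening** (rule 3 read upwards with the primitive `t · h(x)`): every one-dimensional
representation `[σ, h]` is ONE Newton–Leibniz instance away from the two-dimensional
`[σ × [0,1], h ∘ init]`. First stub of the constant-length line. -/
def Thickening : Prop :=
  ∀ r : KZ.IntegralRep 1, ∃ R : KZ.IntegralRep 2,
    R.domain = {z | (Fin.init z : Fin 1 → ℝ) ∈ r.domain ∧ 0 ≤ z (Fin.last 1) ∧ z (Fin.last 1) ≤ 1} ∧
      (∀ z ∈ R.domain, R.integrand z = r.integrand (Fin.init z : Fin 1 → ℝ)) ∧
      KZ.of R - KZ.of r ∈ KZ.newtonLeibnizRel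

/-- **StackedPushforward** (the load-bearing stub of the constant-length line, dimension 2): given
finitely many pairwise disjoint `ℚ`-semialgebraic open sheets `σ k ⊆ ℝ` (`k < M`), on each of which
`φ` is `ℚ`-semialgebraic, differentiable with `ℚ`-semialgebraic nowhere-zero derivative `φ'` and
injective, the map `Φ(x, t) = (φ x, (k(x) + t)/M)` (`k(x)` = index of the sheet of `x`) pushes the
thickened representation `[⋃ σ k × (0,1), h ∘ init]` forward in ONE change of variables: there is
`s : IntegralRep 2` with domain `⋃ k, (φ '' σ k) × ((k, k+1)/M)`, integrand
`(X, τ) ↦ M · (h/|φ'|)(φ|_{σ k}⁻¹ X)` on the `k`-th layer, and `[R] − [s] ∈ changeOfVariablesRel`. -/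
def StackedPushforward : Prop :=
  ∀ (M : ℕ) (σ : Fin M → Set ℝ) (φ φ' h : ℝ → ℝ) (G : Fin M → ℝ → ℝ),
    (∀ k, IsOpen (σ k)) →
    (∀ k, Literature.ModelTheory.ExponentialFields.IsSemialgebraic ℚ {p : Fin 1 → ℝ | p 0 ∈ σ k}) →
    (∀ k l, k ≠ l → Disjoint (σ k) (σ l)) →
    (∀ k, IsSemialgebraicFunOn ℚ {p : Fin 1 → ℝ | p 0 ∈ σ k} (fun p => φ (p 0))) →
    (∀ k, IsSemialgebraicFunOn ℚ {p : Fin 1 → ℝ | p 0 ∈ σ k} (fun p => φ' (p 0))) →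
    (∀ k, ∀ x ∈ σ k, HasDerivAt φ (φ' x) x) → (∀ k, ∀ x ∈ σ k, φ' x ≠ 0) →
    (∀ k, ∀ x ∈ σ k, G k (φ x) = x) →
    (∀ k, IsSemialgebraicFunOn ℚ {p : Fin 1 → ℝ | p 0 ∈ φ '' σ k} (fun p => G k (p 0))) →
    ∀ R : KZ.IntegralRep 2,
      R.domain = {z | (∃ k, z 0 ∈ σ k) ∧ 0 < z 1 ∧ z 1 < 1} →
      (∀ z ∈ R.domain, R.integrand z = h (z 0)) →
      ∃ s : KZ.IntegralRep 2,
        s.domain = {w | ∃ k : Fin M, w 0 ∈ φ '' σ k ∧ (k : ℝ) / M < w 1 ∧ w 1 < ((k : ℝ) + 1) / M} ∧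
        (∀ k : Fin M, ∀ w ∈ s.domain, w 0 ∈ φ '' σ k → (k : ℝ) / M < w 1 → w 1 < ((k : ℝ) + 1) / M →
          s.integrand w = M * (h (G k (w 0)) / |φ' (G k (w 0))|)) ∧
        KZ.of R - KZ.of s ∈ KZ.changeOfVariablesRel

end Summit.KontsevichZagierPeriods.KontsevichZagierPeriods.Cruxes.EffectiveXMapChains.SketchIdeator2
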